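import Mathlib.Probability.Distributions.Poisson.Basic
import Mathlib.Probability.Independence.Basic
import Mathlib.Data.Set.Card
import Mathlib.MeasureTheory.Constructions.BorelSpace.Basic
import Mathlib.MeasureTheory.MeasurableSpace.Instances
import Mathlib.Topology.Algebra.Group.Basic
import HarnessLib

-- provenance: harness21/H21/H21/Prelude/AnalysisL/PoissonPointProcess.lean @ 391abd3 (interim HEAD d8f2665); M5 mechanical rewrite
/-!
# Poisson point processes (trunk T-KINETIC, group G28 AnalysisL, item P10)

Locally finite simple point configurations on a topological space `E` and the predicate
"`P` is (the law of) a Poisson point process with intensity measure `ν`". This is the generic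
probabilistic input for random scatterer configurations of the Lorentz gas
(`hard_sphere_dynamics/boltzmann_grad_limit_notion`, hilbert6.S22).

## Main definitions

* `Literature.PointConfig E`: locally finite subsets of `E` (finite intersection with every compact set),
  with a `SetLike` instance, `PointConfig.count c s : ℕ∞` (number of points in `s`),
  `PointConfig.restrict`, `PointConfig.translate`, `PointConfig.union`.
* the σ-algebra on `PointConfig E` generated by the counting maps `c ↦ c.count s`, `s` measurable
  (`PointConfig.instMeasurableSpace`), and `PointConfig.measurable_count`.
* `Literature.IsPoissonPointProcess ν P`: `P` is a probability measure on `PointConfig E` under which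
  `count s` is Poisson with mean `ν s` for every measurable `s` of finite `ν`-measure and counts of
  pairwise disjoint measurable sets are independent (Kingman, *Poisson Processes* (1993), §2.1).

## Main statements (sorried)

* `existsUnique_isPoissonPointProcess`: existence and uniqueness for a locally finite atomless
  intensity on a second countable locally compact Hausdorff space (Kingman 1993, §2.5 Existence
  Theorem; Rényi 1967 uniqueness).
* `IsPoissonPointProcess.map_translate`, `.restrict`, `.superposition` (Kingman 1993, §2.2–2.3:
  Restriction, Superposition and Mapping Theorems).

## Mathlib

Mathlib (pin v4.32.0) has `ProbabilityTheory.poissonMeasure : ℝ≥0 → Measure ℕ`,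
`ProbabilityTheory.iIndepFun`, `Set.encard`, `ENat.instMeasurableSpace = ⊤`, but no point
processes / random measures; everything below is new and lives in `namespace Literature`.

## Design

Configurations are *simple* (a set, not a multiset/counting measure); this is what the Lorentz
gas needs and it forces the intensity of a Poisson process to be atomless. Counts are `ℕ∞`-valued
(`Set.encard`) so that `count` is total; for a Poisson process they are a.s. finite on sets of finite
intensity (`IsPoissonPointProcess.count_ae_lt_top`).
-/

open MeasureTheory ProbabilityTheory
open scoped ENNReal NNReal

namespace Literature.Analysis.FunctionSpaces

variable {E : Type*} [TopologicalSpace E]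

/-- A *locally finite (simple) point configuration* in a topological space `E`: a subset whose
intersection with every compact set is finite. Kingman, *Poisson Processes* (1993), §2.1;
Daley–Vere-Jones, *An Introduction to the Theory of Point Processes* II (2008), §9.1. [cite: II2008] -/
structure PointConfig (E : Type*) [TopologicalSpace E] where
  /-- The underlying set of points. -/
  carrier : Set E
  /-- Local finiteness: only finitely many points in each compact set. -/
  finite_inter_isCompact : ∀ K : Set E, IsCompact K → (carrier ∩ K).Finite

namespace PointConfig

/-- A point configuration "is" its set of points (Kingman 1993, §2.1). [cite: Kingman1993, §2.1] -/
instance instSetLike : SetLike (PointConfig E) E where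
  coe := PointConfig.carrier
  coe_injective c d h := by cases c; cases d; congr

/-- Membership in the carrier is membership in the configuration. [folklore] -/
@[simp] lemma mem_carrier {c : PointConfig E} {x : E} : x ∈ c.carrier ↔ x ∈ c := Iff.rfl

/-- The `SetLike` coercion is the carrier. [folklore] -/
@[simp] lemma coe_eq_carrier (c : PointConfig E) : (c : Set E) = c.carrier := rfl

/-- Two configurations with the same points are equal (Kingman 1993, §2.1). [cite: Kingman1993, §2.1] -/
@[ext] theorem ext {c d : PointConfig E} (h : ∀ x, x ∈ c ↔ x ∈ d) : c = d := SetLike.ext h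

/-- The empty configuration (Kingman 1993, §2.1). [cite: Kingman1993, §2.1] -/
protected def empty : PointConfig E where
  carrier := ∅
  finite_inter_isCompact K _ := by simp

/-- `∅` is the empty configuration (Kingman 1993, §2.1). [cite: Kingman1993, §2.1] -/
instance : EmptyCollection (PointConfig E) := ⟨PointConfig.empty⟩

/-- Configurations are inhabited by `∅`. [folklore] -/
instance : Inhabited (PointConfig E) := ⟨∅⟩

/-- The empty configuration has empty carrier. [folklore] -/
@[simp] lemma carrier_empty : (∅ : PointConfig E).carrier = ∅ := rfl

/-- The number of points of the configuration `c` in the set `s`, as an extended natural number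
`N(s) ∈ ℕ∞` (Kingman 1993, §2.1, the counting variables `N(A)`). [cite: Kingman1993, §2.1  the counting variables  N(A] -/
noncomputable def count (c : PointConfig E) (s : Set E) : ℕ∞ := (c.carrier ∩ s).encard

/-- The empty configuration has no points anywhere (Kingman 1993, §2.1). [cite: Kingman1993, §2.1] -/
@[simp] theorem count_empty (s : Set E) : (∅ : PointConfig E).count s = 0 := by
  simp [count]

/-- `N(s)` is monotone in `s` (Kingman 1993, §2.1). [cite: Kingman1993, §2.1] -/
theorem count_mono (c : PointConfig E) {s t : Set E} (h : s ⊆ t) : c.count s ≤ c.count t :=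
  Set.encard_le_encard (Set.inter_subset_inter_right _ h)

/-- A configuration has finitely many points in every compact set (Kingman 1993, §2.1). [cite: Kingman1993, §2.1] -/
theorem count_lt_top_of_isCompact (c : PointConfig E) {K : Set E} (hK : IsCompact K) :
    c.count K < ⊤ :=
  (c.finite_inter_isCompact K hK).encard_lt_top

/-- Restriction of a configuration to a set `s`: keep only the points in `s`
(Kingman 1993, §2.2 Restriction Theorem). [cite: Kingman1993, §2.2 Restriction Theorem] -/
protected def restrict (s : Set E) (c : PointConfig E) : PointConfig E where
  carrier := c.carrier ∩ s
  finite_inter_isCompact K hK :=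
    (c.finite_inter_isCompact K hK).subset fun _ hx => ⟨hx.1.1, hx.2⟩

/-- Carrier of a restricted configuration (Kingman 1993, §2.2). [cite: Kingman1993, §2.2] -/
@[simp] lemma carrier_restrict (s : Set E) (c : PointConfig E) :
    (c.restrict s).carrier = c.carrier ∩ s := rfl

/-- Counting after restriction: `N_{c|s}(t) = N_c(s ∩ t)` (Kingman 1993, §2.2). [cite: Kingman1993, §2.2] -/
theorem count_restrict (s : Set E) (c : PointConfig E) (t : Set E) :
    (c.restrict s).count t = c.count (s ∩ t) := by
  simp [count, Set.inter_assoc]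

/-- Union (superposition) of two configurations (Kingman 1993, §2.2 Superposition Theorem). [cite: Kingman1993, §2.2 Superposition Theorem] -/
protected def union (c d : PointConfig E) : PointConfig E where
  carrier := c.carrier ∪ d.carrier
  finite_inter_isCompact K hK := by
    rw [Set.union_inter_distrib_right]
    exact (c.finite_inter_isCompact K hK).union (d.finite_inter_isCompact K hK)

/-- `c ∪ d` is the superposition of two configurations (Kingman 1993, §2.2). [cite: Kingman1993, §2.2] -/
instance : Union (PointConfig E) := ⟨PointConfig.union⟩

/-- Carrier of a superposition (Kingman 1993, §2.2). [cite: Kingman1993, §2.2] -/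
@[simp] lemma carrier_union (c d : PointConfig E) :
    (c ∪ d).carrier = c.carrier ∪ d.carrier := rfl

section translate

variable [AddGroup E] [ContinuousAdd E]

/-- Translation of a configuration by `v`: the image under `x ↦ x + v`. Local finiteness is
preserved because translation is a homeomorphism (Kingman 1993, §2.3 Mapping Theorem). [cite: Kingman1993, §2.3 Mapping Theorem] -/
protected def translate (v : E) (c : PointConfig E) : PointConfig E where
  carrier := (· + v) '' c.carrier
  finite_inter_isCompact K hK := by
    rw [← Set.image_inter_preimage]
    exact (c.finite_inter_isCompact _ ((Homeomorph.addRight v).isCompact_preimage.2 hK)).image _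

/-- Carrier of a translated configuration (Kingman 1993, §2.3). [cite: Kingman1993, §2.3] -/
@[simp] lemma carrier_translate (v : E) (c : PointConfig E) :
    (c.translate v).carrier = (· + v) '' c.carrier := rfl

/-- Counting after translation: `N_{c+v}(s) = N_c(s - v)` (Kingman 1993, §2.3). [cite: Kingman1993, §2.3] -/
theorem count_translate (v : E) (c : PointConfig E) (s : Set E) :
    (c.translate v).count s = c.count ((· + v) ⁻¹' s) := by
  simp only [count, carrier_translate, ← Set.image_inter_preimage]
  exact (add_left_injective v).encard_image _

end translate

/-! ### The σ-algebra generated by the counting maps -/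

/-- The σ-algebra on configurations generated by the counting maps `c ↦ c.count s` for
measurable `s ⊆ E` (Kingman 1993, §2.1; Daley–Vere-Jones II (2008), §9.1). [cite: Kingman1993, §2.1] -/
noncomputable instance instMeasurableSpace [MeasurableSpace E] : MeasurableSpace (PointConfig E) :=
  ⨆ (s : Set E) (_ : MeasurableSet s), (⊤ : MeasurableSpace ℕ∞).comap fun c => c.count s

variable [MeasurableSpace E]

/-- The counting maps `N(s)` are measurable for measurable `s` (Kingman 1993, §2.1). [cite: Kingman1993, §2.1] -/
@[fun_prop]
theorem measurable_count {s : Set E} (hs : MeasurableSet s) :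
    Measurable fun c : PointConfig E => c.count s := by
  rw [measurable_iff_comap_le]
  exact le_iSup₂ (f := fun (s : Set E) (_ : MeasurableSet s) =>
    (⊤ : MeasurableSpace ℕ∞).comap fun c : PointConfig E => c.count s) s hs

/-- A map into configurations is measurable as soon as all its counting maps are
(universal property of the generated σ-algebra; Kingman 1993, §2.1). [cite: Kingman1993, §2.1] -/
theorem measurable_of_count {α : Type*} [MeasurableSpace α] {f : α → PointConfig E}
    (hf : ∀ s : Set E, MeasurableSet s → Measurable fun a => (f a).count s) : Measurable f := by
  rw [measurable_iff_comap_le]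
  change MeasurableSpace.comap f (⨆ (s : Set E) (_ : MeasurableSet s), _) ≤ _
  simp only [MeasurableSpace.comap_iSup, MeasurableSpace.comap_comp]
  exact iSup₂_le fun s hs => (hf s hs).comap_le

/-- Restriction to a measurable set is measurable (Kingman 1993, §2.2). [cite: Kingman1993, §2.2] -/
@[fun_prop]
theorem measurable_restrict {s : Set E} (hs : MeasurableSet s) :
    Measurable (PointConfig.restrict s : PointConfig E → PointConfig E) :=
  measurable_of_count fun t ht => by
    simp only [count_restrict]; exact measurable_count (hs.inter ht)

/-- Translation is measurable (Kingman 1993, §2.3). [cite: Kingman1993, §2.3] -/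
@[fun_prop]
theorem measurable_translate [AddGroup E] [ContinuousAdd E] [BorelSpace E] (v : E) :
    Measurable (PointConfig.translate v : PointConfig E → PointConfig E) :=
  measurable_of_count fun t ht => by
    simp only [count_translate]
    exact measurable_count ((continuous_add_const v).measurable ht)

/-- Superposition `(c, d) ↦ c ∪ d` is measurable on a second countable Hausdorff space
(distinct points are separated by disjoint basic open sets, so `{N_{c ∪ d}(s) ≥ k}` is a countable
union of count events; Kingman 1993, §2.2). [cite: Kingman1993, §2.2] -/
def measurable_union : Prop :=
  ∀ [T2Space E] [SecondCountableTopology E] [OpensMeasurableSpace E],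
    Measurable fun p : PointConfig E × PointConfig E => p.1 ∪ p.2

end PointConfig

/-! ### Poisson point processes -/

section Poisson

variable [MeasurableSpace E]

/-- `P` is (the law of) a *Poisson point process* on `E` with intensity (mean) measure `ν`:
`P` is a probability measure on locally finite simple configurations such that
(i) for every measurable `s` with `ν s < ∞` the count `N(s)` is Poisson distributed with mean
`ν s`, and (ii) the counts of finitely many pairwise disjoint measurable sets are independent.
Kingman, *Poisson Processes* (1993), §2.1 (definition of a Poisson process). [folklore] -/
def IsPoissonPointProcess (ν : Measure E) (P : Measure (PointConfig E)) : Prop :=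
  IsProbabilityMeasure P ∧
  (∀ s, MeasurableSet s → ν s ≠ ∞ →
    P.map (fun c => c.count s) = (poissonMeasure (ν s).toNNReal).map (↑)) ∧
  ∀ (n : ℕ) (s : Fin n → Set E), (∀ i, MeasurableSet (s i)) → Pairwise (Function.onFun Disjoint s) →
    iIndepFun (fun i c => c.count (s i)) P

namespace IsPoissonPointProcess

variable {ν : Measure E} {P : Measure (PointConfig E)}

/-- A Poisson point process is a probability measure (Kingman 1993, §2.1). [cite: Kingman1993, §2.1] -/
theorem isProbabilityMeasure (h : IsPoissonPointProcess ν P) : IsProbabilityMeasure P := h.1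

/-- The one-dimensional marginals of a Poisson point process are Poisson (Kingman 1993, §2.1). [cite: Kingman1993, §2.1] -/
theorem map_count (h : IsPoissonPointProcess ν P) {s : Set E} (hs : MeasurableSet s)
    (hν : ν s ≠ ∞) :
    P.map (fun c => c.count s) = (poissonMeasure (ν s).toNNReal).map (↑) :=
  h.2.1 s hs hν

/-- Counts of pairwise disjoint measurable sets are independent (Kingman 1993, §2.1). [cite: Kingman1993, §2.1] -/
theorem iIndepFun_count (h : IsPoissonPointProcess ν P) {n : ℕ} {s : Fin n → Set E}
    (hs : ∀ i, MeasurableSet (s i)) (hd : Pairwise (Function.onFun Disjoint s)) :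
    iIndepFun (fun i c => c.count (s i)) P :=
  h.2.2 n s hs hd

/-- Under a Poisson point process, a set of finite intensity a.s. contains finitely many points
(Kingman 1993, §2.1). [cite: Kingman1993, §2.1] -/
theorem count_ae_lt_top (h : IsPoissonPointProcess ν P) {s : Set E} (hs : MeasurableSet s)
    (hν : ν s ≠ ∞) : ∀ᵐ c ∂P, c.count s < ⊤ := by
  rw [ae_iff]
  have hm := PointConfig.measurable_count (E := E) hs
  have h1 : {c : PointConfig E | ¬ c.count s < ⊤} = (fun c => c.count s) ⁻¹' {⊤} := by
    ext; simp
  rw [h1, ← Measure.map_apply hm (measurableSet_singleton _), h.map_count hs hν,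
    Measure.map_apply measurable_from_top (measurableSet_singleton _)]
  have h2 : ((↑) : ℕ → ℕ∞) ⁻¹' {⊤} = ∅ := by ext; simp
  simp [h2]

/-- The intensity of a (simple) Poisson point process has no atoms of finite mass at measurable
points: `N({x})` is `{0,1}`-valued and Poisson, hence has mean `0` (Kingman 1993, §2.1–2.2). (If
`ν {x} = ∞` the definition puts no constraint on `N({x})`, whence the hypothesis `hfin`.) [cite: Kingman1993, §2.1–2.2] -/
def measure_singleton : Prop :=
  ∀ (h : IsPoissonPointProcess ν P) {x : E} (hx : MeasurableSet ({x} : Set E)) (hfin : ν {x} ≠ ∞),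
    ν {x} = 0

/-- **Restriction Theorem.** Restricting a Poisson process with intensity `ν` to a measurable
set `s` gives a Poisson process with intensity `ν.restrict s` (Kingman 1993, §2.2). [cite: Kingman1993, §2.2] -/
protected def restrict : Prop :=
  ∀ (h : IsPoissonPointProcess ν P) {s : Set E} (hs : MeasurableSet s),
    IsPoissonPointProcess (ν.restrict s) (P.map (PointConfig.restrict s))

/-- **Mapping Theorem** for translations: translating a Poisson process with intensity `ν` by
`v` gives a Poisson process with intensity the push-forward `ν.map (· + v)`
(Kingman 1993, §2.3). [cite: Kingman1993, §2.3] -/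
def translate : Prop :=
  ∀ [AddGroup E] [ContinuousAdd E] [BorelSpace E] (h : IsPoissonPointProcess ν P) (v : E),
    IsPoissonPointProcess (ν.map (· + v)) (P.map (PointConfig.translate v))

/-- A Poisson process with translation-invariant intensity (e.g. a Haar measure) is
translation invariant in law (Kingman 1993, §2.3 Mapping Theorem, with Rényi's uniqueness of the
law on the count σ-algebra). [cite: Kingman1993, §2.3 Mapping Theorem  with Rényi's uniqu] -/
def map_translate : Prop :=
  ∀ [AddGroup E] [ContinuousAdd E] [BorelSpace E] [SigmaFinite ν] (h : IsPoissonPointProcess ν P) (v : E) (hν : ν.map (· + v) = ν),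
    P.map (PointConfig.translate v) = P

/-- **Superposition Theorem.** The union of two independent Poisson processes with intensities
`ν₁`, `ν₂` is a Poisson process with intensity `ν₁ + ν₂` (Kingman 1993, §2.2; on a second countable
Hausdorff space, where the two processes a.s. share no point by the Disjointness Lemma). [cite: Kingman1993, §2.2] -/
def superposition : Prop :=
  ∀ [T2Space E] [SecondCountableTopology E] [BorelSpace E] {ν₁ ν₂ : Measure E} [SigmaFinite ν₁] [SigmaFinite ν₂] {P₁ P₂ : Measure (PointConfig E)} (h₁ : IsPoissonPointProcess ν₁ P₁) (h₂ : IsPoissonPointProcess ν₂ P₂),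
    IsPoissonPointProcess (ν₁ + ν₂)
      ((P₁.prod P₂).map fun p : PointConfig E × PointConfig E => p.1 ∪ p.2)

/-- **Rényi's theorem** (uniqueness): two Poisson point processes with the same σ-finite intensity
have the same law on the σ-algebra generated by the counts — the finite-dimensional laws of the
counts are determined by (i)–(ii) via disjoint refinements into sets of finite intensity, and count
cylinders form a generating π-system (Rényi 1967; Kingman 1993, §3.4). σ-finiteness is needed:
for `ν = ∞ • μ` condition (i) is void. [cite: Renyi1967] -/
def unique : Prop :=
  ∀ [SigmaFinite ν] {P' : Measure (PointConfig E)} (h : IsPoissonPointProcess ν P) (h' : IsPoissonPointProcess ν P'),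
    P = P'

end IsPoissonPointProcess

/-- **Existence Theorem** (Kingman 1993, §2.5) with Rényi uniqueness: on a second countable
locally compact Hausdorff space, every locally finite atomless Borel measure `ν` is the intensity
of a unique Poisson point process on locally finite simple configurations. [cite: Kingman1993, §2.5] -/
def existsUnique_isPoissonPointProcess : Prop :=
  ∀ [T2Space E] [SecondCountableTopology E] [LocallyCompactSpace E] [BorelSpace E] (ν : Measure E) [IsLocallyFiniteMeasure ν] (hν : ∀ x, ν {x} = 0),
    ∃! P : Measure (PointConfig E), IsPoissonPointProcess ν P

end Poisson

end Literature.Analysis.FunctionSpaces
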